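import Literature.Analysis.FluidPDE.OnsagerBDSVDeformationBoundsProofs
import Literature.Analysis.FluidPDE.OnsagerBDSVMikadoBounds
import HarnessLib

/-!
# The BDSV perturbation: proof of the conjugated-stress bound (Prop. 5.7, arXiv (5.24))

Buckmaster–De Lellis–Székelyhidi–Vicol (BDSV), *Onsager's conjecture for admissible weak
solutions*, CPAM 72 (2019) = arXiv:1701.08678, Prop. 5.7, second item (arXiv (5.24)): for
`t ∈ Ĩ_i` and `N ≥ 0`, `‖R̃_{q,i}‖_N ≲ ℓ^{-N}`. The printed proof: (5.23) `‖∇Φ_i‖_N ≲ ℓ^{-N}`;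
on `supp R̊̄_q` the normalised stress is (5.27) `R_{q,i}/ρ_{q,i} = Id - (Σ_j∫η_j²/ρ_q) R̊̄_q`, so
that by (5.15) and (2.20), (5.28) `‖R_{q,i}/ρ_{q,i}‖_N ≲ 1 + (λ_q^α/δ_{q+1})‖R̊̄_q‖_{N+α}
≲ ℓ^{-N}`; "Therefore `‖R̃_{q,i}‖_N ≲ ‖∇Φ_i‖_N‖∇Φ_i‖₀ + ‖R_{q,i}/ρ_{q,i}‖_N ≲ ℓ^{-N}`".

This file PROVES the named fact `BDSV.tildeRBound` of `OnsagerBDSVDeformationBounds.lean`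
(`BDSV.tildeRBound_holds`) along these lines, for the honest objects of
`OnsagerBDSVPerturbation.lean` (`BDSV.tildeR` is the (5.27)/(5.32) form
`∇Φ_i (Id - (Σ∫η²/ρ_q)R̊̄_q) ∇Φ_iᵀ` globally), on top of the proof of (5.23)
(`OnsagerBDSVDeformationBoundsProofs.lean`: the all-orders displacement bound
`BDSV.displacement_allOrders`, `BDSV.eContDiffHolderNorm_gradPhi_le`):

* `BDSV.eContDiffHolderNorm_bilinear_scale_le`: the Leibniz estimate in the scale-weighted
  form "bounds `A ℓ^{-j}` at all orders `j ≤ N` are stable under continuous bilinear maps"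
  (from `Torus.eContDiffHolderNorm_bilinear_le`), and its linear counterpart;
* `BDSV.holder_displacement_tildeInterval`: for every `N` a constant `K(N)` with
  `‖Φ_i(t) - id‖_{m+1,0} ≤ 3K|C_in|ℓ^{2α} ℓ^{-m}` for `t ∈ Ĩ_i`, `m ≤ N`, under the CFL-type
  smallness `3K|C_in|ℓ^{2α} ≤ 1` (the transport bound on
  `J_i = [max(0,tᵢ-τ_q), min(T,tᵢ+2τ_q)] ⊇ Ĩ_i`, an interval of length `≤ 3τ_q` containing the
  anchor `min(tᵢ,T)`, with `τ_q δ_q^{1/2}λ_q = ℓ^{2α}`) — whence `‖∇Φ_i(t)‖_{j,0} ≤ 18 ℓ^{-j}`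
  (`BDSV.gradPhi_scale_le`);
* `BDSV.normalisedStress_scale_le`: `‖Id - (Σ∫η²/ρ_q)R̊̄_q(t)‖_{j,0} ≤ (1 + 24|C_in|) ℓ^{-j}` for
  `t ∈ [0,T]`, `j ≤ N ≤ N̄` ((5.27)–(5.28): `0 ≤ Σ∫η²/ρ_q ≤ 8λ_q^α/δ_{q+1}` by (5.15), (5.19);
  (2.20); `‖·‖_{j,0} ≤ 3‖·‖_{j,α}`; `λ_q^α ℓ^α ≤ 1`);
* `BDSV.eContDiffHolderNorm_tildeR_le`: (5.24) at a fixed time with the explicit constant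
  `C(N, |C_in|) = 2916 · 9ᴺ (N+1)² (1 + 24|C_in|)` (written as the product the two Leibniz steps
  produce), through the continuous bilinear matrix product `BDSV.mmul` (`‖AB‖ ≤ 3‖A‖‖B‖` for the
  elementwise norm) and the transposition of `OnsagerBDSVMikadoBounds.lean`;
* `BDSV.tildeRBound_holds`: thresholds `α₀ = 2βb(b-1)` (for (5.15), i.e.
  `4δ_{q+2} ≤ δ_{q+1}λ_q^{-α}`, `BDSV.exists_threshold_four_amp`), `N̄ = N`, and `a₀` from
  `BDSV.exists_threshold_mollScale_rpow_le`.

## References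

* T. Buckmaster, C. De Lellis, L. Székelyhidi Jr., V. Vicol, *Onsager's conjecture for admissible
  weak solutions*, Comm. Pure Appl. Math. 72 (2019) 229–274 = arXiv:1701.08678, §5.5 Prop. 5.7
  (arXiv (5.23)–(5.24), (5.27)–(5.28)) and its proof; Lemma 5.4 (5.15), (5.19); §2.5 (2.19)–(2.20);
  App. A (A.2); App. B Prop. B.1 (B.5)–(B.6). Equation numbers are those of arXiv:1701.08678v1.
-/

open MeasureTheory Set
open scoped NNReal ENNReal ContDiff Matrix Matrix.Norms.Elementwise

noncomputable section

set_option maxSynthPendingDepth 3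

namespace Literature.Analysis.FluidPDE

namespace BDSV

open FunctionSpaces FunctionSpaces.Torus

/-! ## Scale-weighted Leibniz and post-composition estimates -/

section HolderTools

variable {d : Type} [Fintype d] {Y Y₁ Y₂ Z : Type} [NormedAddCommGroup Y] [NormedSpace ℝ Y]
  [NormedAddCommGroup Y₁] [NormedSpace ℝ Y₁] [NormedAddCommGroup Y₂] [NormedSpace ℝ Y₂]
  [NormedAddCommGroup Z] [NormedSpace ℝ Z]

/-- **Scale-weighted Leibniz estimate.** If `‖f‖_{j,0} ≤ A₁ ℓ^{-j}` and `‖g‖_{j,0} ≤ A₂ ℓ^{-j}` for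
all `j ≤ N` (`0 < ℓ`), then for a continuous bilinear `B` with `‖B‖ ≤ b` and every `k ≤ N`,
`‖B(f,g)‖_{k,0} ≤ 3ᴺ (N+1) b A₁ A₂ ℓ^{-k}` (Leibniz `Torus.eContDiffHolderNorm_bilinear_le` and
`ℓ^{-j} ℓ^{-(k-j)} = ℓ^{-k}`; BDSV App. A (A.2) in the form in which Prop. 5.7 is assembled:
bounds `≲ ℓ^{-N}` at all orders are stable under products). [cite: BuckmasterEtAl2018, App. A (A.2)] -/
theorem eContDiffHolderNorm_bilinear_scale_le (B : Y₁ →L[ℝ] Y₂ →L[ℝ] Z) {N : ℕ}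
    {f : UnitAddTorus d → Y₁} {g : UnitAddTorus d → Y₂} (hf : IsContDiff N f) (hg : IsContDiff N g)
    {b ℓ A₁ A₂ : ℝ} (hBb : ‖B‖ ≤ b) (hℓ : 0 < ℓ) (hA₁ : 0 ≤ A₁) (hA₂ : 0 ≤ A₂)
    (hfb : ∀ j ≤ N, Torus.eContDiffHolderNorm j 0 f ≤ ENNReal.ofReal (A₁ * ℓ ^ (-(j : ℝ))))
    (hgb : ∀ j ≤ N, Torus.eContDiffHolderNorm j 0 g ≤ ENNReal.ofReal (A₂ * ℓ ^ (-(j : ℝ)))) :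
    ∀ k ≤ N, Torus.eContDiffHolderNorm k 0 (fun x => B (f x) (g x)) ≤
      ENNReal.ofReal (3 ^ N * ((N : ℝ) + 1) * b * (A₁ * A₂) * ℓ ^ (-(k : ℝ))) := by
  intro k hk
  have hfk : IsContDiff k f := hf.of_le (by exact_mod_cast hk)
  have hgk : IsContDiff k g := hg.of_le (by exact_mod_cast hk)
  have hb0 : 0 ≤ b := (norm_nonneg _).trans hBb
  refine (Torus.eContDiffHolderNorm_bilinear_le B hfk hgk 0).trans ?_
  have hX0 : 0 ≤ A₁ * A₂ * ℓ ^ (-(k : ℝ)) := by positivity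
  have hterm : ∀ j ∈ Finset.range (k + 1),
      Torus.eContDiffHolderNorm j 0 f * Torus.eContDiffHolderNorm (k - j) 0 g ≤
        ENNReal.ofReal (A₁ * A₂ * ℓ ^ (-(k : ℝ))) := by
    intro j hj
    have hjk : j ≤ k := Nat.lt_succ_iff.1 (Finset.mem_range.1 hj)
    calc Torus.eContDiffHolderNorm j 0 f * Torus.eContDiffHolderNorm (k - j) 0 g
        ≤ ENNReal.ofReal (A₁ * ℓ ^ (-(j : ℝ))) * ENNReal.ofReal (A₂ * ℓ ^ (-((k - j : ℕ) : ℝ))) :=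
          mul_le_mul' (hfb j (hjk.trans hk)) (hgb (k - j) ((Nat.sub_le k j).trans hk))
      _ = ENNReal.ofReal (A₁ * A₂ * ℓ ^ (-(k : ℝ))) := by
          rw [← ENNReal.ofReal_mul (by positivity)]
          congr 1
          rw [Nat.cast_sub hjk]
          calc A₁ * ℓ ^ (-(j : ℝ)) * (A₂ * ℓ ^ (-((k : ℝ) - j)))
              = A₁ * A₂ * (ℓ ^ (-(j : ℝ)) * ℓ ^ (-((k : ℝ) - j))) := by ring
            _ = A₁ * A₂ * ℓ ^ (-(k : ℝ)) := by
                rw [← Real.rpow_add hℓ]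
                ring_nf
  have hsum : ∑ j ∈ Finset.range (k + 1),
      Torus.eContDiffHolderNorm j 0 f * Torus.eContDiffHolderNorm (k - j) 0 g ≤
        ENNReal.ofReal (((k : ℝ) + 1) * (A₁ * A₂ * ℓ ^ (-(k : ℝ)))) := by
    refine (Finset.sum_le_sum hterm).trans (le_of_eq ?_)
    rw [Finset.sum_const, Finset.card_range, nsmul_eq_mul, ← ENNReal.ofReal_natCast, Nat.cast_succ,
      ← ENNReal.ofReal_mul (by positivity)]
  have hB : (3 : ℝ≥0∞) ^ k * ‖B‖ₑ ≤ ENNReal.ofReal (3 ^ k * b) := by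
    rw [ENNReal.ofReal_mul (by positivity), ENNReal.ofReal_pow (by norm_num), ENNReal.ofReal_ofNat,
      ← ofReal_norm]
    exact mul_le_mul' le_rfl (ENNReal.ofReal_le_ofReal hBb)
  calc (3 : ℝ≥0∞) ^ k * ‖B‖ₑ * ∑ j ∈ Finset.range (k + 1),
        Torus.eContDiffHolderNorm j 0 f * Torus.eContDiffHolderNorm (k - j) 0 g
      ≤ ENNReal.ofReal (3 ^ k * b) * ENNReal.ofReal (((k : ℝ) + 1) * (A₁ * A₂ * ℓ ^ (-(k : ℝ)))) :=
        mul_le_mul' hB hsum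
    _ = ENNReal.ofReal (3 ^ k * ((k : ℝ) + 1) * b * (A₁ * A₂) * ℓ ^ (-(k : ℝ))) := by
        rw [← ENNReal.ofReal_mul (by positivity)]
        congr 1
        ring
    _ ≤ ENNReal.ofReal (3 ^ N * ((N : ℝ) + 1) * b * (A₁ * A₂) * ℓ ^ (-(k : ℝ))) := by
        refine ENNReal.ofReal_le_ofReal ?_
        have h3 : (3 : ℝ) ^ k ≤ 3 ^ N := pow_le_pow_right₀ (by norm_num) hk
        have hkN : (k : ℝ) + 1 ≤ N + 1 := by exact_mod_cast Nat.succ_le_succ hk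
        have hr : 0 ≤ ℓ ^ (-(k : ℝ)) := Real.rpow_nonneg hℓ.le _
        have := mul_le_mul h3 hkN (by positivity) (by positivity)
        calc 3 ^ k * ((k : ℝ) + 1) * b * (A₁ * A₂) * ℓ ^ (-(k : ℝ))
            = (3 ^ k * ((k : ℝ) + 1)) * (b * (A₁ * A₂) * ℓ ^ (-(k : ℝ))) := by ring
          _ ≤ (3 ^ N * ((N : ℝ) + 1)) * (b * (A₁ * A₂) * ℓ ^ (-(k : ℝ))) :=
              mul_le_mul_of_nonneg_right this (by positivity)
          _ = _ := by ring

/-- **Post-composition with a bounded linear map**: `‖L ∘ f‖_{k,0} ≤ l X` if `‖L‖ ≤ l` and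
`‖f‖_{k,0} ≤ X`. [folklore] -/
theorem eContDiffHolderNorm_clm_comp_le_of_le (L : Y →L[ℝ] Z) {k : ℕ} {f : UnitAddTorus d → Y}
    (hf : IsContDiff k f) {l X : ℝ} (hl : ‖L‖ ≤ l)
    (h : Torus.eContDiffHolderNorm k 0 f ≤ ENNReal.ofReal X) :
    Torus.eContDiffHolderNorm k 0 (fun x => L (f x)) ≤ ENNReal.ofReal (l * X) := by
  have hl0 : 0 ≤ l := (norm_nonneg _).trans hl
  refine (Torus.eContDiffHolderNorm_clm_comp_le L hf 0).trans ?_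
  rw [ENNReal.ofReal_mul hl0, ← ofReal_norm]
  exact mul_le_mul' (ENNReal.ofReal_le_ofReal hl) h

/-- **Scale-weighted post-composition**: if `‖f‖_{j,0} ≤ A ℓ^{-j}` for `j ≤ N` and `‖L‖ ≤ l`, then
`‖L ∘ f‖_{j,0} ≤ l A ℓ^{-j}` for `j ≤ N`. [folklore] -/
theorem eContDiffHolderNorm_clm_scale_le (L : Y →L[ℝ] Z) {N : ℕ} {f : UnitAddTorus d → Y}
    (hf : IsContDiff N f) {l ℓ A : ℝ} (hl : ‖L‖ ≤ l)
    (hfb : ∀ j ≤ N, Torus.eContDiffHolderNorm j 0 f ≤ ENNReal.ofReal (A * ℓ ^ (-(j : ℝ)))) :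
    ∀ j ≤ N, Torus.eContDiffHolderNorm j 0 (fun x => L (f x)) ≤
      ENNReal.ofReal (l * A * ℓ ^ (-(j : ℝ))) := by
  intro j hj
  rw [mul_assoc]
  exact eContDiffHolderNorm_clm_comp_le_of_le L (hf.of_le (by exact_mod_cast hj)) hl (hfb j hj)

end HolderTools

/-! ## Matrix fields: elementwise norms, products and transposes -/

section MatrixTools

/-- `‖Id‖ ≤ 1` for the elementwise sup norm on `3 × 3` matrices (a private copy of the lemma
of `OnsagerBDSVEnergyCrossTerm.lean`, to keep the import graph of the deformation bounds
disjoint from the energy estimates). [folklore] -/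
private theorem matrixNorm_one_le : ‖(1 : Matrix (Fin 3) (Fin 3) ℝ)‖ ≤ 1 := by
  refine (Matrix.norm_le_iff zero_le_one).2 fun i j => ?_
  rw [Matrix.one_apply]
  split_ifs <;> simp

/-- `‖A B‖ ≤ 3 ‖A‖ ‖B‖` for the elementwise sup norm on `3 × 3` matrices (three terms in each
entry; a private copy of the lemma of `OnsagerBDSVEnergyTools.lean`, same reason). [folklore] -/
private theorem matrixNorm_mul_le (A B : Matrix (Fin 3) (Fin 3) ℝ) : ‖A * B‖ ≤ 3 * ‖A‖ * ‖B‖ := by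
  refine (Matrix.norm_le_iff (by positivity)).2 fun i j => ?_
  rw [Matrix.mul_apply]
  calc ‖∑ k, A i k * B k j‖ ≤ ∑ k, ‖A i k * B k j‖ := norm_sum_le _ _
    _ ≤ ∑ _k : Fin 3, ‖A‖ * ‖B‖ := Finset.sum_le_sum fun k _ => by
        rw [norm_mul]
        exact mul_le_mul (Matrix.norm_entry_le_entrywise_sup_norm A)
          (Matrix.norm_entry_le_entrywise_sup_norm B) (norm_nonneg _) (norm_nonneg _)
    _ = 3 * ‖A‖ * ‖B‖ := by
        rw [Finset.sum_const, Finset.card_univ, Fintype.card_fin, nsmul_eq_mul]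
        push_cast
        ring

/-- `‖ofCols S‖ ≤ ‖S‖` (an entry of a column is at most the Euclidean norm of the column). [folklore] -/
theorem norm_ofCols_le (S : Fin 3 → EuclideanSpace ℝ (Fin 3)) : ‖ofCols S‖ ≤ ‖S‖ := by
  refine (Matrix.norm_le_iff (norm_nonneg _)).2 fun i j => ?_
  rw [ofCols_apply]
  exact (PiLp.norm_apply_le (S j) i).trans (norm_le_pi_norm S j)

/-- Products of `C^n` matrix fields on `T³` are `C^n` (entrywise). [folklore] -/
theorem isContDiff_matrix_mul {n : ℕ} {F₁ F₂ : UnitAddTorus (Fin 3) → Matrix (Fin 3) (Fin 3) ℝ}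
    (h₁ : IsContDiff n F₁) (h₂ : IsContDiff n F₂) : IsContDiff n (fun x => F₁ x * F₂ x) := by
  refine contDiff_pi.2 fun a => contDiff_pi.2 fun b => ?_
  have e : (fun y => lift (fun x => F₁ x * F₂ x) y a b) =
      fun y => ∑ k, lift F₁ y a k * lift F₂ y k b := by
    funext y
    simp only [lift_apply, Matrix.mul_apply]
  rw [e]
  exact ContDiff.sum fun k _ =>
    (contDiff_pi.1 (contDiff_pi.1 h₁ a) k).mul (contDiff_pi.1 (contDiff_pi.1 h₂ k) b)

/-- Transposes of `C^n` matrix fields on `T³` are `C^n`. [folklore] -/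
theorem isContDiff_matrix_transpose {n : ℕ} {F : UnitAddTorus (Fin 3) → Matrix (Fin 3) (Fin 3) ℝ}
    (h : IsContDiff n F) : IsContDiff n (fun x => (F x)ᵀ) := by
  refine contDiff_pi.2 fun a => contDiff_pi.2 fun b => ?_
  have e : (fun y => lift (fun x => (F x)ᵀ) y a b) = fun y => lift F y b a := by
    funext y
    simp only [lift_apply, Matrix.transpose_apply]
  rw [e]
  exact contDiff_pi.1 (contDiff_pi.1 h b) a

end MatrixTools

/-! ## The displacements `Φ_i - id` on `Ĩ_i` at all orders -/

section Displacement

variable {P : Params} {S : Setting} {Nbar : ℕ} {Cin C₀ c₀ : ℝ} {Cη : ℕ → ℕ → ℝ}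

/-- Geometry of `Ĩ_i`: for `τ, T > 0` and `t ∈ Ĩ_i`, the interval
`J_i = [max(0, tᵢ - τ), min(T, tᵢ + 2τ)]` is nondegenerate, lies in `[0,T]`, contains `t` and the
anchor `min(tᵢ, T)` of `Φ_i`, and has length `≤ 3τ`. [cite: BuckmasterEtAl2018, §5.2 (iv)] -/
theorem tildeInterval_geometry {T τ : ℝ} (hT : 0 < T) (hτ : 0 < τ) {i : ℕ} {t : ℝ}
    (ht : t ∈ tildeInterval T τ i) :
    max 0 ((i : ℝ) * τ - τ) < min T ((i : ℝ) * τ + 2 * τ) ∧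
      Icc (max 0 ((i : ℝ) * τ - τ)) (min T ((i : ℝ) * τ + 2 * τ)) ⊆ Icc 0 T ∧
      t ∈ Icc (max 0 ((i : ℝ) * τ - τ)) (min T ((i : ℝ) * τ + 2 * τ)) ∧
      min ((i : ℝ) * τ) T ∈ Icc (max 0 ((i : ℝ) * τ - τ)) (min T ((i : ℝ) * τ + 2 * τ)) ∧
      min T ((i : ℝ) * τ + 2 * τ) - max 0 ((i : ℝ) * τ - τ) ≤ 3 * τ := by
  obtain ⟨⟨ht0, htT⟩, ht1, ht2⟩ := ht
  have hi : (0 : ℝ) ≤ (i : ℝ) * τ := mul_nonneg i.cast_nonneg hτ.le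
  refine ⟨?_, ?_, ?_, ?_, ?_⟩
  · rw [max_lt_iff, lt_min_iff, lt_min_iff]
    exact ⟨⟨hT, by linarith⟩, ⟨by linarith, by linarith⟩⟩
  · intro s hs
    exact ⟨(le_max_left _ _).trans hs.1, hs.2.trans (min_le_left _ _)⟩
  · exact ⟨max_le ht0 (by linarith), le_min htT (by linarith)⟩
  · exact ⟨max_le (le_min hi hT.le) (le_min (by linarith) (by linarith)),
      le_min (min_le_right _ _) ((min_le_left _ _).trans (by linarith))⟩
  · have h1 : min T ((i : ℝ) * τ + 2 * τ) ≤ (i : ℝ) * τ + 2 * τ := min_le_right _ _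
    have h2 : (i : ℝ) * τ - τ ≤ max 0 ((i : ℝ) * τ - τ) := le_max_right _ _
    linarith

/-- **The displacements on `Ĩ_i` at all orders** (the content of App. B (B.5)–(B.6) for the
backward flows of `v̄_q`, as used in the proof of Prop. 5.7: "`‖∇Φ_i‖_N ≲ 1 + τ_q‖Dv̄_q‖_N
≲ 1 + τ_q δ_q^{1/2} λ_q ℓ^{-N}`", `τ_q δ_q^{1/2} λ_q = ℓ^{2α}`). For every `N` there is
`K = K(N) ≥ 2` such that, under the standing hypotheses with `N̄ ≥ N` and the CFL-type smallness
`3 K |C_in| ℓ^{2α} ≤ 1`, for all `i`, `t ∈ Ĩ_i` and `m ≤ N`: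
`‖D_i(t)‖_{m+1,0} ≤ 3 K |C_in| ℓ^{2α} ℓ^{-m}` (`D_i = Φ_i - id`; the transport bound
`BDSV.displacement_allOrders` on `J_i = [max(0,tᵢ-τ_q), min(T,tᵢ+2τ_q)] ⊇ Ĩ_i`, `|J_i| ≤ 3τ_q`).
[cite: BuckmasterEtAl2018, Prop. 5.7 (proof of (5.23)); App. B (B.5)–(B.6)] -/
theorem holder_displacement_tildeInterval (N : ℕ) : ∃ K : ℝ, 2 ≤ K ∧
    ∀ {P : Params} {S : Setting} {Nbar : ℕ} {Cin C₀ c₀ : ℝ} {Cη : ℕ → ℕ → ℝ}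
      (_ : PerturbationHypotheses P S Nbar Cin C₀) (𝒟 : PerturbationData P S c₀ Cη),
      1 ≤ P.a → 1 ≤ P.b → 0 ≤ P.β → 0 ≤ P.α → N ≤ Nbar →
      3 * K * (|Cin| * mollScale P.β P.α P.a P.b S.q ^ (2 * P.α)) ≤ 1 →
      ∀ (i : ℕ), ∀ t ∈ tildeInterval S.T (P.τ S.q) i, ∀ m ≤ N,
        Torus.eContDiffHolderNorm (m + 1) 0 (𝒟.D i t) ≤
          ENNReal.ofReal (3 * K * (|Cin| * mollScale P.β P.α P.a P.b S.q ^ (2 * P.α)) *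
            mollScale P.β P.α P.a P.b S.q ^ (-(m : ℝ))) := by
  obtain ⟨K, hK2, hK⟩ := displacement_allOrders (d := Fin 3) N
  refine ⟨K, hK2, ?_⟩
  intro P S Nbar Cin C₀ c₀ Cη H 𝒟 ha hb hβ hα hN hCFL i t ht m hm
  have hK0 : 0 ≤ K := zero_le_two.trans hK2
  have hτ : 0 < P.τ S.q := glueScale_pos ha S.q
  have hℓ : 0 < mollScale P.β P.α P.a P.b S.q := mollScale_pos ha S.q
  have hℓ1 : mollScale P.β P.α P.a P.b S.q ≤ 1 := mollScale_le_one_of_params ha hb hβ hα S.q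
  set ℓ := mollScale P.β P.α P.a P.b S.q with hℓdef
  set M := ℓ⁻¹ with hMdef
  have hM1 : 1 ≤ M := (one_le_inv₀ hℓ).2 hℓ1
  have hMk : ∀ k : ℕ, 1 ≤ M ^ k := fun k => one_le_pow₀ hM1
  have hMpow : ∀ n : ℕ, ℓ ^ (-(n : ℝ)) = M ^ n := fun n => by
    rw [Real.rpow_neg hℓ.le, Real.rpow_natCast, hMdef, inv_pow]
  obtain ⟨hab, hsub, htJ, ht₀, hlen⟩ := tildeInterval_geometry H.pos_T hτ ht
  set a' := max 0 ((i : ℝ) * P.τ S.q - P.τ S.q) with ha'def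
  set b' := min S.T ((i : ℝ) * P.τ S.q + 2 * P.τ S.q) with hb'def
  -- (2.19) in the form `‖v̄_q(s)‖_{j+1,0} ≤ Λ M^j`, `Λ = |C_in| δ_q^{1/2} λ_q`
  set Λ := |Cin| * (Real.sqrt (amp P.β P.a P.b S.q) * freq P.a P.b S.q) with hΛdef
  have hX0 : 0 ≤ Real.sqrt (amp P.β P.a P.b S.q) * freq P.a P.b S.q :=
    mul_nonneg (Real.sqrt_nonneg _) (freq_pos ha _).le
  have hΛ0 : 0 ≤ Λ := mul_nonneg (abs_nonneg _) hX0
  have hΛτ : Λ * P.τ S.q = |Cin| * ℓ ^ (2 * P.α) :=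
    velocityBound_mul_tau (P := P) (Cin := |Cin|) ha S.q
  have hvb : ∀ s ∈ Icc a' b', ∀ j ≤ N,
      Torus.eContDiffHolderNorm (j + 1) 0 (S.vbar s) ≤ ENNReal.ofReal (Λ * M ^ j) := by
    intro s hs j hj
    refine (H.velocity j (hj.trans hN) s (hsub hs)).trans (ENNReal.ofReal_le_ofReal ?_)
    rw [hMpow j, hΛdef]
    calc Cin * (Real.sqrt (amp P.β P.a P.b S.q) * freq P.a P.b S.q * M ^ j)
        ≤ |Cin| * (Real.sqrt (amp P.β P.a P.b S.q) * freq P.a P.b S.q * M ^ j) :=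
          mul_le_mul_of_nonneg_right (le_abs_self Cin) (mul_nonneg hX0 (zero_le_one.trans (hMk j)))
      _ = _ := by ring
  -- the transport equation of `D_i`, restricted to `J_i`
  have heq0 : ∀ s ∈ Icc 0 S.T, ∀ x, timeDerivWithin (Icc 0 S.T) (𝒟.D i) s x +
      convect (S.vbar s) (𝒟.D i s) x = -S.vbar s x :=
    fun s hs x => eq_neg_of_add_eq_zero_left ((𝒟.flow i).transport s hs x)
  have hDsm : IsSmoothSpaceTimeOn (Icc 0 S.T) (𝒟.D i) := (𝒟.flow i).smooth
  have heq := transport_restrict hab hsub hDsm heq0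
  -- smallness on `J_i`
  have hsmall : (b' - a') * Λ * K ≤ 1 := by
    calc (b' - a') * Λ * K ≤ (3 * P.τ S.q) * Λ * K :=
          mul_le_mul_of_nonneg_right (mul_le_mul_of_nonneg_right hlen hΛ0) hK0
      _ = 3 * K * (Λ * P.τ S.q) := by ring
      _ = 3 * K * (|Cin| * ℓ ^ (2 * P.α)) := by rw [hΛτ]
      _ ≤ 1 := hCFL
  have h := hK hab (H.eulerReynolds.smooth_velocity.mono hsub) (hDsm.mono hsub) heq ht₀
    (𝒟.flow i).anchor hΛ0 hM1 hvb hsmall t htJ m hm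
  refine h.trans (ENNReal.ofReal_le_ofReal ?_)
  rw [hMpow m]
  refine mul_le_mul_of_nonneg_right ?_ (zero_le_one.trans (hMk m))
  calc K * ((b' - a') * Λ) ≤ K * ((3 * P.τ S.q) * Λ) :=
        mul_le_mul_of_nonneg_left (mul_le_mul_of_nonneg_right hlen hΛ0) hK0
    _ = 3 * K * (Λ * P.τ S.q) := by ring
    _ = 3 * K * (|Cin| * ℓ ^ (2 * P.α)) := by rw [hΛτ]

end Displacement

/-! ## The two factors of `R̃_{q,i} = ∇Φ_i (Id - (Σ∫η²/ρ_q) R̊̄_q) ∇Φ_iᵀ` -/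

section Factors

variable {P : Params} {S : Setting} {Nbar : ℕ} {Cin C₀ c₀ : ℝ} {Cη : ℕ → ℕ → ℝ}

/-- **`∇Φ_i(t)` at all levels**: if `‖D_i(t)‖_{m+1,0} ≤ E ℓ^{-m}` for `m ≤ N` with `E ≤ 1`
(`0 < ℓ ≤ 1`), then `‖∇Φ_i(t)‖_{j,0} ≤ 18 ℓ^{-j}` for `j ≤ N` (through
`BDSV.eContDiffHolderNorm_gradPhi_le`: `‖∇Φ_i‖_{j} ≤ 9(1 + ‖D_i‖_{j+1})`).
[cite: BuckmasterEtAl2018, Prop. 5.7 (arXiv (5.23))] -/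
theorem gradPhi_scale_le {D : ℕ → ℝ → UnitAddTorus (Fin 3) → EuclideanSpace ℝ (Fin 3)} {i : ℕ} {t : ℝ}
    (hD : IsSmooth (D i t)) {N : ℕ} {ℓ E : ℝ} (hℓ : 0 < ℓ) (hℓ1 : ℓ ≤ 1) (hE1 : E ≤ 1)
    (hDb : ∀ m ≤ N, Torus.eContDiffHolderNorm (m + 1) 0 (D i t) ≤
      ENNReal.ofReal (E * ℓ ^ (-(m : ℝ)))) :
    ∀ j ≤ N, Torus.eContDiffHolderNorm j 0 (fun x => gradPhi D i t x) ≤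
      ENNReal.ofReal (18 * ℓ ^ (-(j : ℝ))) := by
  intro j hj
  refine (eContDiffHolderNorm_gradPhi_le hD j 0).trans ?_
  have hr1 : 1 ≤ ℓ ^ (-(j : ℝ)) :=
    Real.one_le_rpow_of_pos_of_le_one_of_nonpos hℓ hℓ1 (neg_nonpos.2 (Nat.cast_nonneg j))
  have hEr : E * ℓ ^ (-(j : ℝ)) ≤ ℓ ^ (-(j : ℝ)) := by
    calc E * ℓ ^ (-(j : ℝ)) ≤ 1 * ℓ ^ (-(j : ℝ)) :=
          mul_le_mul_of_nonneg_right hE1 (zero_le_one.trans hr1)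
      _ = _ := one_mul _
  calc (9 : ℝ≥0∞) * (1 + Torus.eContDiffHolderNorm (j + 1) 0 (D i t))
      ≤ 9 * (1 + ENNReal.ofReal (ℓ ^ (-(j : ℝ)))) := by
        gcongr
        exact (hDb j hj).trans (ENNReal.ofReal_le_ofReal hEr)
    _ = ENNReal.ofReal (9 * (1 + ℓ ^ (-(j : ℝ)))) := by
        rw [ENNReal.ofReal_mul (by norm_num), ENNReal.ofReal_ofNat,
          ENNReal.ofReal_add zero_le_one (zero_le_one.trans hr1), ENNReal.ofReal_one]
    _ ≤ ENNReal.ofReal (18 * ℓ ^ (-(j : ℝ))) := ENNReal.ofReal_le_ofReal (by linarith)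

/-- **The normalising coefficient**: `0 ≤ Σ_j∫η_j²/ρ_q ≤ 8 λ_q^α/δ_{q+1}` on `[0,T]`, from
`Σ_j∫η_j² ∈ [0,1]` ((5.19)) and `ρ_q ≥ δ_{q+1}λ_q^{-α}/8` ((5.15), given
`4δ_{q+2} ≤ δ_{q+1}λ_q^{-α}`). [cite: BuckmasterEtAl2018, Lemma 5.4 (5.15), (5.19)] -/
theorem PerturbationData.etaMass_div_rhoQ_le (H : PerturbationHypotheses P S Nbar Cin C₀)
    (𝒟 : PerturbationData P S c₀ Cη) (ha : 1 ≤ P.a)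
    (h4 : 4 * amp P.β P.a P.b (S.q + 2) ≤ amp P.β P.a P.b (S.q + 1) * freq P.a P.b S.q ^ (-P.α))
    {t : ℝ} (ht : t ∈ Icc 0 S.T) :
    0 ≤ etaMass P S 𝒟.cut.η t / rhoQ P S t ∧
      etaMass P S 𝒟.cut.η t / rhoQ P S t ≤
        8 * freq P.a P.b S.q ^ P.α / amp P.β P.a P.b (S.q + 1) := by
  have hδ : 0 < amp P.β P.a P.b (S.q + 1) := amp_pos ha _
  have hfr : 0 < freq P.a P.b S.q ^ (-P.α) := Real.rpow_pos_of_pos (freq_pos ha _) _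
  have hρ : amp P.β P.a P.b (S.q + 1) * freq P.a P.b S.q ^ (-P.α) / 8 ≤ rhoQ P S t :=
    H.le_rhoQ h4 ht
  have hρ0 : 0 < rhoQ P S t := lt_of_lt_of_le (by positivity) hρ
  have hS1 : etaMass P S 𝒟.cut.η t ≤ 1 := 𝒟.etaMass_le_one ht
  have hS0 : 0 ≤ etaMass P S 𝒟.cut.η t :=
    Finset.sum_nonneg fun j _ => integral_nonneg fun y => sq_nonneg _
  refine ⟨div_nonneg hS0 hρ0.le, ?_⟩
  rw [div_le_div_iff₀ hρ0 hδ]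
  have h2 : 8 * freq P.a P.b S.q ^ P.α * (amp P.β P.a P.b (S.q + 1) * freq P.a P.b S.q ^ (-P.α) / 8) =
      amp P.β P.a P.b (S.q + 1) := by
    have h : freq P.a P.b S.q ^ P.α * freq P.a P.b S.q ^ (-P.α) = 1 := by
      rw [← Real.rpow_add (freq_pos ha _), add_neg_cancel, Real.rpow_zero]
    calc 8 * freq P.a P.b S.q ^ P.α * (amp P.β P.a P.b (S.q + 1) * freq P.a P.b S.q ^ (-P.α) / 8)
        = amp P.β P.a P.b (S.q + 1) * (freq P.a P.b S.q ^ P.α * freq P.a P.b S.q ^ (-P.α)) := by ring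
      _ = _ := by rw [h, mul_one]
  calc etaMass P S 𝒟.cut.η t * amp P.β P.a P.b (S.q + 1) ≤ 1 * amp P.β P.a P.b (S.q + 1) :=
        mul_le_mul_of_nonneg_right hS1 hδ.le
    _ = 8 * freq P.a P.b S.q ^ P.α * (amp P.β P.a P.b (S.q + 1) * freq P.a P.b S.q ^ (-P.α) / 8) := by
        rw [one_mul, h2]
    _ ≤ 8 * freq P.a P.b S.q ^ P.α * rhoQ P S t :=
        mul_le_mul_of_nonneg_left hρ (mul_nonneg (by norm_num) (Real.rpow_nonneg (freq_pos ha _).le _))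

/-- **The normalised stress `R_{q,i}/ρ_{q,i} = Id - (Σ_j∫η_j²/ρ_q) R̊̄_q` ((5.27)) at all levels**:
for `t ∈ [0,T]` and `j ≤ N ≤ N̄`, `‖Id - (Σ∫η²/ρ_q) R̊̄_q(t)‖_{j,0} ≤ (1 + 24|C_in|) ℓ^{-j}` — the
estimate (5.28) "`‖R_{q,i}/ρ_{q,i}‖_N ≲ 1 + (λ_q^α/δ_{q+1}) ‖R̊̄_q‖_{N+α} ≲ 1 + ℓ^{-N+α} λ_q^α
≲ ℓ^{-N}`", from (5.15), (2.20), `‖·‖_{j,0} ≤ 3‖·‖_{j,α}` and `λ_q^α ℓ^α ≤ 1` (the matrix field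
is written with `BDSV.ofColsCLM`, the continuous-linear form of `BDSV.ofCols`, of norm `≤ 1`).
[cite: BuckmasterEtAl2018, Prop. 5.7 (arXiv (5.27)–(5.28))] -/
theorem normalisedStress_scale_le (H : PerturbationHypotheses P S Nbar Cin C₀)
    (𝒟 : PerturbationData P S c₀ Cη) (ha : 1 ≤ P.a) (hb : 1 ≤ P.b) (hβ : 0 ≤ P.β) (hα : 0 ≤ P.α)
    {N : ℕ} (hN : N ≤ Nbar)
    (h4 : 4 * amp P.β P.a P.b (S.q + 2) ≤ amp P.β P.a P.b (S.q + 1) * freq P.a P.b S.q ^ (-P.α))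
    {t : ℝ} (ht : t ∈ Icc 0 S.T) :
    ∀ j ≤ N, Torus.eContDiffHolderNorm j 0
        ((fun _ : UnitAddTorus (Fin 3) => (1 : Matrix (Fin 3) (Fin 3) ℝ)) -
          (etaMass P S 𝒟.cut.η t / rhoQ P S t) • fun x => ofColsCLM (S.Rbar t x)) ≤
      ENNReal.ofReal ((1 + 24 * |Cin|) * mollScale P.β P.α P.a P.b S.q ^ (-(j : ℝ))) := by
  intro j hj
  have hℓ : 0 < mollScale P.β P.α P.a P.b S.q := mollScale_pos ha S.q
  have hℓ1 : mollScale P.β P.α P.a P.b S.q ≤ 1 := mollScale_le_one_of_params ha hb hβ hα S.q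
  have hδ : 0 < amp P.β P.a P.b (S.q + 1) := amp_pos ha _
  have hlam : 0 < freq P.a P.b S.q := freq_pos ha _
  have hlamℓ : freq P.a P.b S.q ^ P.α * mollScale P.β P.α P.a P.b S.q ^ P.α ≤ 1 := by
    calc freq P.a P.b S.q ^ P.α * mollScale P.β P.α P.a P.b S.q ^ P.α
        ≤ freq P.a P.b S.q ^ P.α * freq P.a P.b S.q ^ (-P.α) :=
          mul_le_mul_of_nonneg_left (mollScale_rpow_le ha hb hβ hα S.q) (Real.rpow_nonneg hlam.le _)
      _ = 1 := by rw [← Real.rpow_add hlam, add_neg_cancel, Real.rpow_zero]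
  set ℓ := mollScale P.β P.α P.a P.b S.q with hℓdef
  set c := etaMass P S 𝒟.cut.η t / rhoQ P S t with hcdef
  obtain ⟨hc0, hc⟩ := 𝒟.etaMass_div_rhoQ_le H ha h4 ht
  have hrpos : ∀ x : ℝ, 0 < ℓ ^ x := fun x => Real.rpow_pos_of_pos hℓ x
  -- smoothness
  have hR : IsSmooth (S.Rbar t) := H.eulerReynolds.smooth_stress.isSmooth_slice ht
  have hF : IsSmooth (fun x => ofColsCLM (S.Rbar t x)) := hR.comp_clm ofColsCLM
  have h1 : IsContDiff j (fun _ : UnitAddTorus (Fin 3) => (1 : Matrix (Fin 3) (Fin 3) ℝ)) :=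
    isContDiff_const _
  have hFj : IsContDiff j (fun x => ofColsCLM (S.Rbar t x)) :=
    hF.isContDiff (by exact_mod_cast le_top)
  have h2 : IsContDiff j (c • fun x => ofColsCLM (S.Rbar t x)) := hFj.smul c
  have hRj : IsContDiff j (S.Rbar t) := hR.isContDiff (by exact_mod_cast le_top)
  -- (2.20) in `C^{j,0}`, then through `ofCols` (norm `≤ 1`)
  set X : ℝ := 3 * (|Cin| * (amp P.β P.a P.b (S.q + 1) * ℓ ^ (-(j : ℝ) + P.α))) with hXdef
  have hX0 : 0 ≤ X := mul_nonneg (by norm_num) (mul_nonneg (abs_nonneg _) (mul_nonneg hδ.le (hrpos _).le))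
  have hst : Torus.eContDiffHolderNorm j 0 (S.Rbar t) ≤ ENNReal.ofReal X := by
    refine (Torus.eContDiffHolderNorm_exponent_zero_le j (Real.toNNReal P.α) _).trans ?_
    rw [hXdef, ENNReal.ofReal_mul (by norm_num), ENNReal.ofReal_ofNat]
    refine mul_le_mul' le_rfl ((H.stress j (hj.trans hN) t ht).trans (ENNReal.ofReal_le_ofReal ?_))
    exact mul_le_mul_of_nonneg_right (le_abs_self Cin) (mul_nonneg hδ.le (hrpos _).le)
  have hFb : Torus.eContDiffHolderNorm j 0 (fun x => ofColsCLM (S.Rbar t x)) ≤ ENNReal.ofReal (1 * X) :=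
    eContDiffHolderNorm_clm_comp_le_of_le ofColsCLM hRj
      (ContinuousLinearMap.opNorm_le_bound _ zero_le_one fun R =>
        (norm_ofCols_le R).trans_eq (one_mul _).symm) hst
  have hr1 : 1 ≤ ℓ ^ (-(j : ℝ)) :=
    Real.one_le_rpow_of_pos_of_le_one_of_nonpos hℓ hℓ1 (neg_nonpos.2 (Nat.cast_nonneg j))
  have hsplit : ℓ ^ (-(j : ℝ) + P.α) = ℓ ^ (-(j : ℝ)) * ℓ ^ P.α := Real.rpow_add hℓ _ _
  -- the key real inequality `c X ≤ 24 |C_in| ℓ^{-j}`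
  have key : |c| * (1 * X) ≤ 24 * |Cin| * ℓ ^ (-(j : ℝ)) := by
    rw [abs_of_nonneg hc0, one_mul, hXdef, hsplit]
    have hY : 0 ≤ 3 * (|Cin| * (amp P.β P.a P.b (S.q + 1) * (ℓ ^ (-(j : ℝ)) * ℓ ^ P.α))) :=
      mul_nonneg (by norm_num) (mul_nonneg (abs_nonneg _)
        (mul_nonneg hδ.le (mul_nonneg (hrpos _).le (hrpos _).le)))
    have hZ : 0 ≤ 24 * |Cin| * ℓ ^ (-(j : ℝ)) :=
      mul_nonneg (mul_nonneg (by norm_num) (abs_nonneg _)) (hrpos _).le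
    calc c * (3 * (|Cin| * (amp P.β P.a P.b (S.q + 1) * (ℓ ^ (-(j : ℝ)) * ℓ ^ P.α))))
        ≤ (8 * freq P.a P.b S.q ^ P.α / amp P.β P.a P.b (S.q + 1)) *
            (3 * (|Cin| * (amp P.β P.a P.b (S.q + 1) * (ℓ ^ (-(j : ℝ)) * ℓ ^ P.α)))) :=
          mul_le_mul_of_nonneg_right hc hY
      _ = 24 * |Cin| * ℓ ^ (-(j : ℝ)) * (freq P.a P.b S.q ^ P.α * ℓ ^ P.α) := by
          field_simp
          ring
      _ ≤ 24 * |Cin| * ℓ ^ (-(j : ℝ)) * 1 := mul_le_mul_of_nonneg_left hlamℓ hZ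
      _ = _ := mul_one _
  calc Torus.eContDiffHolderNorm j 0
        ((fun _ : UnitAddTorus (Fin 3) => (1 : Matrix (Fin 3) (Fin 3) ℝ)) -
          c • fun x => ofColsCLM (S.Rbar t x))
      ≤ Torus.eContDiffHolderNorm j 0 (fun _ : UnitAddTorus (Fin 3) => (1 : Matrix (Fin 3) (Fin 3) ℝ)) +
          Torus.eContDiffHolderNorm j 0 (c • fun x => ofColsCLM (S.Rbar t x)) :=
        Torus.eContDiffHolderNorm_sub_le h1 h2
    _ ≤ ‖(1 : Matrix (Fin 3) (Fin 3) ℝ)‖ₑ + ‖c‖ₑ * ENNReal.ofReal (1 * X) := by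
        rw [Torus.eContDiffHolderNorm_const_smul hFj c]
        exact add_le_add (eContDiffHolderNorm_const_le j 0 _) (mul_le_mul' le_rfl hFb)
    _ = ENNReal.ofReal (‖(1 : Matrix (Fin 3) (Fin 3) ℝ)‖ + |c| * (1 * X)) := by
        rw [ENNReal.ofReal_add (norm_nonneg _) (mul_nonneg (abs_nonneg _) (by rw [one_mul]; exact hX0)),
          ofReal_norm, ENNReal.ofReal_mul (abs_nonneg _), Real.enorm_eq_ofReal_abs]
    _ ≤ ENNReal.ofReal ((1 + 24 * |Cin|) * ℓ ^ (-(j : ℝ))) := by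
        refine ENNReal.ofReal_le_ofReal ?_
        have h1' : ‖(1 : Matrix (Fin 3) (Fin 3) ℝ)‖ ≤ 1 * ℓ ^ (-(j : ℝ)) :=
          matrixNorm_one_le.trans (by rw [one_mul]; exact hr1)
        calc ‖(1 : Matrix (Fin 3) (Fin 3) ℝ)‖ + |c| * (1 * X)
            ≤ 1 * ℓ ^ (-(j : ℝ)) + 24 * |Cin| * ℓ ^ (-(j : ℝ)) := add_le_add h1' key
          _ = _ := by ring

end Factors

/-! ## Proof of Prop. 5.7, second item (arXiv (5.24)) -/

section Assembly

variable {P : Params} {S : Setting} {Nbar : ℕ} {Cin C₀ c₀ : ℝ} {Cη : ℕ → ℕ → ℝ}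

/-- **(5.24) at a fixed time.** Under the standing hypotheses (`N ≤ N̄`,
`4δ_{q+2} ≤ δ_{q+1}λ_q^{-α}`), if `‖D_i(t)‖_{m+1,0} ≤ E ℓ^{-m}` for `m ≤ N` with `E ≤ 1` at some
`t ∈ [0,T]`, then `‖R̃_{q,i}(t)‖_{N,0} ≤ C ℓ^{-N}` with the explicit constant
`C = (3ᴺ(N+1)·3) · ((3ᴺ(N+1)·3 · 18(1 + 24|C_in|)) · 18)`: the printed assembly
"`‖R̃_{q,i}‖_N ≲ ‖∇Φ_i‖_N ‖∇Φ_i‖₀ + ‖R_{q,i}/ρ_{q,i}‖_N`" as two Leibniz estimates for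
`R̃ = (∇Φ_i M) ∇Φ_iᵀ`, `M = Id - (Σ∫η²/ρ_q)R̊̄_q`, through the continuous bilinear matrix product
`BDSV.mmul` (`‖A B‖ ≤ 3‖A‖‖B‖`) and the transposition `BDSV.mtranspose` (an isometry) of
`OnsagerBDSVMikadoBounds.lean`. [cite: BuckmasterEtAl2018, Prop. 5.7 (arXiv (5.24)), proof] -/
theorem eContDiffHolderNorm_tildeR_le (H : PerturbationHypotheses P S Nbar Cin C₀)
    (𝒟 : PerturbationData P S c₀ Cη) (ha : 1 ≤ P.a) (hb : 1 ≤ P.b) (hβ : 0 ≤ P.β) (hα : 0 ≤ P.α)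
    {N : ℕ} (hN : N ≤ Nbar)
    (h4 : 4 * amp P.β P.a P.b (S.q + 2) ≤ amp P.β P.a P.b (S.q + 1) * freq P.a P.b S.q ^ (-P.α))
    {E : ℝ} (hE1 : E ≤ 1) {i : ℕ} {t : ℝ} (ht : t ∈ Icc 0 S.T)
    (hDb : ∀ m ≤ N, Torus.eContDiffHolderNorm (m + 1) 0 (𝒟.D i t) ≤
      ENNReal.ofReal (E * mollScale P.β P.α P.a P.b S.q ^ (-(m : ℝ)))) :
    Torus.eContDiffHolderNorm N 0 (tildeR P S 𝒟.cut.η 𝒟.D i t) ≤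
      ENNReal.ofReal ((3 ^ N * ((N : ℝ) + 1) * 3) *
        ((3 ^ N * ((N : ℝ) + 1) * 3 * (18 * (1 + 24 * |Cin|))) * (1 * 18)) *
        mollScale P.β P.α P.a P.b S.q ^ (-(N : ℝ))) := by
  have hℓ : 0 < mollScale P.β P.α P.a P.b S.q := mollScale_pos ha S.q
  have hℓ1 : mollScale P.β P.α P.a P.b S.q ≤ 1 := mollScale_le_one_of_params ha hb hβ hα S.q
  have hDt : IsSmooth (𝒟.D i t) := (𝒟.flow i).smooth.isSmooth_slice ht
  have hR : IsSmooth (S.Rbar t) := H.eulerReynolds.smooth_stress.isSmooth_slice ht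
  set c := etaMass P S 𝒟.cut.η t / rhoQ P S t with hcdef
  -- the two factors at all levels
  have hG := gradPhi_scale_le hDt hℓ hℓ1 hE1 hDb
  have hM := normalisedStress_scale_le H 𝒟 ha hb hβ hα hN h4 ht
  have hA₂ : (0 : ℝ) ≤ 1 + 24 * |Cin| := by positivity
  -- smoothness of the factors
  have hGc : IsContDiff N (fun x => gradPhi 𝒟.D i t x) := isContDiff_gradPhi hDt N
  have hFN : IsContDiff N (fun x => ofColsCLM (S.Rbar t x)) :=
    (hR.comp_clm ofColsCLM).isContDiff (by exact_mod_cast le_top)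
  have hMc : IsContDiff N ((fun _ : UnitAddTorus (Fin 3) => (1 : Matrix (Fin 3) (Fin 3) ℝ)) -
      c • fun x => ofColsCLM (S.Rbar t x)) :=
    (isContDiff_const _).sub (hFN.smul c)
  -- operator norms: `‖mmul‖ ≤ 3`, `‖mtranspose‖ ≤ 1`
  have hmmul := ContinuousLinearMap.opNorm_le_bound₂ mmul (by norm_num : (0 : ℝ) ≤ 3)
    fun A B => matrixNorm_mul_le A B
  have hmt := ContinuousLinearMap.opNorm_le_bound mtranspose zero_le_one
    fun A => ((Matrix.norm_transpose A).trans (one_mul _).symm).le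
  -- first Leibniz: `∇Φ_i M`
  have hGM := eContDiffHolderNorm_bilinear_scale_le mmul hGc hMc hmmul hℓ (by norm_num) hA₂ hG hM
  have hGMc : IsContDiff N (fun x => gradPhi 𝒟.D i t x *
      ((fun _ : UnitAddTorus (Fin 3) => (1 : Matrix (Fin 3) (Fin 3) ℝ)) -
        c • fun x => ofColsCLM (S.Rbar t x)) x) :=
    isContDiff_matrix_mul hGc hMc
  have hGM' : ∀ k ≤ N, Torus.eContDiffHolderNorm k 0 (fun x => gradPhi 𝒟.D i t x *
      ((fun _ : UnitAddTorus (Fin 3) => (1 : Matrix (Fin 3) (Fin 3) ℝ)) -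
        c • fun x => ofColsCLM (S.Rbar t x)) x) ≤
        ENNReal.ofReal (3 ^ N * ((N : ℝ) + 1) * 3 * (18 * (1 + 24 * |Cin|)) *
          mollScale P.β P.α P.a P.b S.q ^ (-(k : ℝ))) := hGM
  -- the transpose
  have hGt := eContDiffHolderNorm_clm_scale_le mtranspose hGc hmt hG
  have hGtc : IsContDiff N (fun x => (gradPhi 𝒟.D i t x)ᵀ) := isContDiff_matrix_transpose hGc
  have hGt' : ∀ j ≤ N, Torus.eContDiffHolderNorm j 0 (fun x => (gradPhi 𝒟.D i t x)ᵀ) ≤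
      ENNReal.ofReal (1 * 18 * mollScale P.β P.α P.a P.b S.q ^ (-(j : ℝ))) := hGt
  -- second Leibniz
  have hA₃ : 0 ≤ 3 ^ N * ((N : ℝ) + 1) * 3 * (18 * (1 + 24 * |Cin|)) := by positivity
  have hA₄ : (0 : ℝ) ≤ 1 * 18 := by norm_num
  have hfin := eContDiffHolderNorm_bilinear_scale_le mmul hGMc hGtc hmmul hℓ hA₃ hA₄ hGM' hGt' N le_rfl
  have e : tildeR P S 𝒟.cut.η 𝒟.D i t = fun x => mmul (gradPhi 𝒟.D i t x *
      ((fun _ : UnitAddTorus (Fin 3) => (1 : Matrix (Fin 3) (Fin 3) ℝ)) -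
        c • fun x => ofColsCLM (S.Rbar t x)) x)
      ((gradPhi 𝒟.D i t x)ᵀ) := by
    funext x
    rfl
  rw [e]
  exact hfin

/-- **The conjugated-stress bound holds** (BDSV Prop. 5.7, second item, arXiv (5.24): for
`t ∈ Ĩ_i` and `N ≥ 0`, `‖R̃_{q,i}‖_N ≲ ℓ^{-N}`, constants depending on `N, α, β` (here also on
`|C_in|`) but not on `a`). Proof as printed: `‖∇Φ_i‖_j ≲ ℓ^{-j}` on `Ĩ_i` ((5.23), through the
all-orders displacement bound `BDSV.holder_displacement_tildeInterval` and the smallness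
`3K|C_in|ℓ^{2α} ≤ 1` for `a ≥ a₀`), `‖R_{q,i}/ρ_{q,i}‖_j ≲ ℓ^{-j}` ((5.27)–(5.28), which needs
(5.15), i.e. `4δ_{q+2} ≤ δ_{q+1}λ_q^{-α}`, true for `α < 2βb(b-1)` and `a ≥ a₁`), and two Leibniz
estimates. Thresholds: `α₀ = 2βb(b-1)`, `N̄ = N`. [cite: BuckmasterEtAl2018, Prop. 5.7 (arXiv (5.24))] -/
theorem tildeRBound_holds : tildeRBound := by
  intro c₀ _hc₀ Cη β hβ _hβ3 b hb1 _hb2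
  have hα₀ : 0 < 2 * β * b * (b - 1) :=
    mul_pos (mul_pos (mul_pos two_pos hβ) (by linarith)) (by linarith)
  refine ⟨2 * β * b * (b - 1), hα₀, ?_⟩
  intro α hα hαb N
  obtain ⟨K, hK2, hK⟩ := holder_displacement_tildeInterval N
  refine ⟨N, ?_⟩
  intro Cin C₀
  obtain ⟨a₁, ha₁1, ha₁⟩ := exists_threshold_four_amp hb1 hαb
  obtain ⟨a₂, _ha₂1, ha₂⟩ :=
    exists_threshold_mollScale_rpow_le hβ.le hb1.le hα (3 * K * |Cin|) one_pos
  refine ⟨(3 ^ N * ((N : ℝ) + 1) * 3) *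
      ((3 ^ N * ((N : ℝ) + 1) * 3 * (18 * (1 + 24 * |Cin|))) * (1 * 18)),
    max a₁ a₂, lt_max_of_lt_left ha₁1, ?_⟩
  intro a ha S H 𝒟 i t ht
  have ha1 : 1 ≤ a := ha₁1.le.trans ((le_max_left _ _).trans ha)
  have h4 := ha₁ a ((le_max_left _ _).trans ha) S.q
  have hCFL : 3 * K * (|Cin| * mollScale β α a b S.q ^ (2 * α)) ≤ 1 := by
    have h := ha₂ a ((le_max_right _ _).trans ha) S.q
    calc 3 * K * (|Cin| * mollScale β α a b S.q ^ (2 * α))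
        = 3 * K * |Cin| * mollScale β α a b S.q ^ (2 * α) := by ring
      _ ≤ 1 := h
  have ht0 : t ∈ Icc 0 S.T := tildeInterval_subset_Icc _ _ _ ht
  have hDb := hK H 𝒟 ha1 hb1.le hβ.le hα.le le_rfl hCFL i t ht
  exact eContDiffHolderNorm_tildeR_le H 𝒟 ha1 hb1.le hβ.le hα.le le_rfl h4 hCFL ht0 hDb

end Assembly

end BDSV

end Literature.Analysis.FluidPDE
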